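import Literature.NumberTheory.EllipticCurves.FormalGroupNegOmegaProofs
import Mathlib.AlgebraicGeometry.EllipticCurve.NormalForms
import HarnessLib

/-!
# The formal group of a Weierstrass model with `a₁ = a₃ = 0`: `[-1](z) = -z`, parity of `w`, `x`,
# `ω`, `D`, and Mazur–Tate oddness as plain oddness (proofs only)

Trunk T-NT-EC (Literature/NumberTheory/EllipticCurves). For a Weierstrass equation with
`a₁ = a₃ = 0` (`y² = x³ + a₂x² + a₄x + a₆`, Mathlib's `IsCharNeTwoNF`; in particular for the short
model `y² = x³ + a₄x + a₆`, `IsShortNF`) the inverse is `-(x, y) = (x, -y)`, so the formal inverse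
law is `i(z) = -z` ON THE NOSE, and the expansions have a parity: `w(-z) = -w(z)`, `x(-z) = x(z)`,
`ω(-z) = ω(z)`, `D(h(-z)) = -(Dh)(-z)`. Consequently the tree's Mazur–Tate oddness
`IsFormallyOdd W σ : σ(i(z)) = -σ(z)` (`PadicSigma.lean`, Harvey 2008 §4) is, for such models,
literally "`σ` is an odd power series", `σ(-z) = -σ(z)` — the form in which Blakestad–Grant 2023
(Thm. 1: "odd under `t ↦ -t`") and Mazur–Tate 1991 state it for `y² = x³ + a₄x + a₆`. This is the
(small) dictionary needed by an existence proof for the Mazur–Tate sigma function of short models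
(`mazur_tate_sigma_existsUnique_of_exists_shortModel`, `PadicSigmaVariableChangeProofs.lean`).

* `formalNeg_of_isCharNeTwoNF` — `i(z) = -z`;
* `isFormallyOdd_iff_rescale_of_isCharNeTwoNF` — `IsFormallyOdd W σ ↔ σ(-z) = -σ(z)`
  (`rescale (-1) σ = -σ`), and `IsFormallyOdd.coeff_eq_zero_of_even` — the even coefficients of a
  Mazur–Tate-odd `σ` vanish (over an additively torsion-free ring);
* `rescale_neg_one_formalW`, `…formalXMulSq`, `…formalEta`, `…formalOmega` — `w` is odd, `z²x`,
  `η = (ω/dz)⁻¹` and `ω/dz` are even; `coeff_formalOmega_eq_zero_of_odd` — the odd coefficients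
  of `ω/dz` vanish (Blakestad–Grant: "there is no quadratic term in the expansion of `ω`");
* `formalInvariantDerivation_rescale_neg_one` — `D(h(-z)) = -(Dh)(-z)`: `D` is odd.

## Sources

* C. Blakestad, D. Grant, J. Number Theory 249 (2023) (arXiv:1903.02480), §2 eq. (2) and Thm. 1
  ("odd under `t → -t`"), proof of Prop. 3(c) ("no quadratic term in the expansion of `ω`").
  [BlakestadGrant2023]
* D. Harvey, *Efficient computation of `p`-adic heights*, LMS J. Comput. Math. 11 (2008), §4
  (`σ(i(t)) = -σ(t)`). [Harvey2008]
* J. H. Silverman, *AEC* 2nd ed. (2009), III.2.3 (`-(x, y) = (x, -y - a₁x - a₃)`), IV.1 (p. 118,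
  `i(z)`). [SilvermanAEC2009]

Pure proof file: no definitions, no named facts.
-/

noncomputable section

open PowerSeries Literature.NumberTheory.EllipticCurves

namespace WeierstrassCurve

variable {R : Type*} [CommRing R] (W : WeierstrassCurve R)

/-- `f(-z)` as a substitution: `f.subst (-z) = rescale (-1) f`. [folklore] -/
theorem _root_.Literature.NumberTheory.EllipticCurves.subst_neg_X_eq_rescale (f : R⟦X⟧) :
    f.subst (-X : R⟦X⟧) = rescale (-1 : R) f := by
  rw [rescale_eq_subst, neg_one_smul]

section CharNeTwoNF

variable [W.IsCharNeTwoNF]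

/-- For `a₁ = a₃ = 0` the denominator `E = 1 - a₁z - a₃w` of `i(z) = -z/E` is `1`. [folklore] -/
theorem formalNegDenom_eq_one_of_isCharNeTwoNF : (1 - C W.a₁ * X - C W.a₃ * W.formalW) = 1 := by
  rw [W.a₁_of_isCharNeTwoNF, W.a₃_of_isCharNeTwoNF, map_zero, zero_mul, zero_mul, sub_zero,
    sub_zero]

/-- **`i(z) = -z` when `a₁ = a₃ = 0`** (`-(x, y) = (x, -y)`, so `z(-P) = -x/(-y) = -z(P)`).
[Silverman AEC III.2.3, IV.1 (p. 118)] [cite: SilvermanAEC2009, IV.1.1] -/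
theorem formalNeg_of_isCharNeTwoNF : W.formalNeg = -X := by
  have h := W.formalNeg_mul_formalNegDenom
  rwa [W.formalNegDenom_eq_one_of_isCharNeTwoNF, mul_one] at h

/-- Substituting the formal inverse is `z ↦ -z`. [folklore] -/
theorem subst_formalNeg_of_isCharNeTwoNF (f : R⟦X⟧) : f.subst W.formalNeg = rescale (-1 : R) f := by
  rw [W.formalNeg_of_isCharNeTwoNF, subst_neg_X_eq_rescale]

/-- **Mazur–Tate oddness is plain oddness for `a₁ = a₃ = 0`:** `σ(i(z)) = -σ(z)` iff
`σ(-z) = -σ(z)`. [Blakestad–Grant 2023, Thm. 1 ("odd under `t → -t`"); Harvey 2008, §4]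
[cite: BlakestadGrant2023, Thm. 1] -/
theorem isFormallyOdd_iff_rescale_of_isCharNeTwoNF {σ : R⟦X⟧} :
    W.IsFormallyOdd σ ↔ rescale (-1 : R) σ = -σ := by
  rw [IsFormallyOdd, W.subst_formalNeg_of_isCharNeTwoNF]

/-- **`w(-z) = -w(z)`**: `w = -1/y` is odd (`y(-P) = -y(P)`). [Silverman AEC IV.1]
[cite: SilvermanAEC2009, IV.1.1] -/
theorem rescale_neg_one_formalW : rescale (-1 : R) W.formalW = -W.formalW := by
  have h := W.formalW_subst_formalNeg_mul_formalNegDenom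
  rwa [W.formalNegDenom_eq_one_of_isCharNeTwoNF, mul_one, W.subst_formalNeg_of_isCharNeTwoNF] at h

/-- **`x(-z) = x(z)`**: `z²x(z)` is even. [Silverman AEC III.2.3, IV.1] [cite: SilvermanAEC2009, IV.1.1] -/
theorem rescale_neg_one_formalXMulSq : rescale (-1 : R) W.formalXMulSq = W.formalXMulSq := by
  have h := W.formalXMulSq_subst_formalNeg
  have h1 : invOfUnit (1 : R⟦X⟧) 1 = 1 := by
    have := mul_invOfUnit (1 : R⟦X⟧) 1 (by simp)
    rwa [one_mul] at this
  rwa [W.formalNegDenom_eq_one_of_isCharNeTwoNF, h1, one_pow, mul_one,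
    W.subst_formalNeg_of_isCharNeTwoNF] at h

/-- **`η(-z) = η(z)`** for `η = 1 - f_w(z, w(z)) = (ω/dz)⁻¹`: the invariant differential is even
(`[-1]^*ω = -ω` and `[-1](z) = -z`). [Silverman AEC III.5.1, IV.1] [cite: SilvermanAEC2009, IV.1.1] -/
theorem rescale_neg_one_formalEta : rescale (-1 : R) W.formalEta = W.formalEta := by
  have h := W.formalEta_mul_derivative_formalNeg
  rw [W.formalNeg_of_isCharNeTwoNF, map_neg, derivative_X, mul_neg, mul_one, neg_inj,
    subst_neg_X_eq_rescale] at h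
  exact h.symm

/-- **`D` is odd: `D(h(-z)) = -(Dh)(-z)`** for the invariant derivation `D = d/ω`.
[Silverman AEC III.5.1] [folklore] -/
theorem formalInvariantDerivation_rescale_neg_one (h : R⟦X⟧) :
    W.formalInvariantDerivation (rescale (-1 : R) h) =
      -rescale (-1 : R) (W.formalInvariantDerivation h) := by
  rw [← W.subst_formalNeg_of_isCharNeTwoNF, ← W.subst_formalNeg_of_isCharNeTwoNF]
  exact W.formalInvariantDerivation_subst_formalNeg h

/-- A series fixed by `z ↦ -z` has `2·aₙ = 0` for odd `n`; over an additively torsion-free ring its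
odd coefficients vanish. [folklore] -/
theorem _root_.Literature.NumberTheory.EllipticCurves.coeff_eq_zero_of_rescale_neg_one_eq_self
    [IsAddTorsionFree R] {f : R⟦X⟧} (h : rescale (-1 : R) f = f) {n : ℕ} (hn : Odd n) :
    coeff n f = 0 := by
  have e := congrArg (coeff n) h
  rw [coeff_rescale, hn.neg_one_pow, neg_one_mul, neg_eq_iff_add_eq_zero, ← two_nsmul] at e
  exact (nsmul_eq_zero_iff.mp e).resolve_right two_ne_zero

/-- A series negated by `z ↦ -z` has vanishing even coefficients (torsion-free ring). [folklore] -/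
theorem _root_.Literature.NumberTheory.EllipticCurves.coeff_eq_zero_of_rescale_neg_one_eq_neg
    [IsAddTorsionFree R] {f : R⟦X⟧} (h : rescale (-1 : R) f = -f) {n : ℕ} (hn : Even n) :
    coeff n f = 0 := by
  have e := congrArg (coeff n) h
  rw [coeff_rescale, hn.neg_one_pow, one_mul, map_neg, eq_neg_iff_add_eq_zero, ← two_nsmul] at e
  exact (nsmul_eq_zero_iff.mp e).resolve_right two_ne_zero

/-- **The even coefficients of a Mazur–Tate-odd `σ` vanish** (`a₁ = a₃ = 0`, torsion-free
coefficients): `σ = z + σ₃z³ + σ₅z⁵ + ⋯`. [Blakestad–Grant 2023, Thm. 1; Mazur–Stein–Tate 2006,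
Thm. 1.3 (`σ = t + (a₁/2)t² + ⋯`, here `a₁ = 0`)] [cite: BlakestadGrant2023, Thm. 1] -/
theorem IsFormallyOdd.coeff_eq_zero_of_even [IsAddTorsionFree R] {σ : R⟦X⟧}
    (hodd : W.IsFormallyOdd σ) {n : ℕ} (hn : Even n) : coeff n σ = 0 :=
  coeff_eq_zero_of_rescale_neg_one_eq_neg (W.isFormallyOdd_iff_rescale_of_isCharNeTwoNF.mp hodd) hn

/-- The even coefficients of `w(z)` vanish (`a₁ = a₃ = 0`, torsion-free ring):
`w = z³ + a₂z⁵ + ⋯`. [Silverman AEC IV.1] [folklore] -/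
theorem coeff_formalW_eq_zero_of_even [IsAddTorsionFree R] {n : ℕ} (hn : Even n) :
    coeff n W.formalW = 0 :=
  coeff_eq_zero_of_rescale_neg_one_eq_neg W.rescale_neg_one_formalW hn

/-- The odd coefficients of `z²x(z)` vanish (`a₁ = a₃ = 0`, torsion-free ring):
`x = z⁻² - a₂ - a₄z² - ⋯`. [Silverman AEC IV.1; Blakestad–Grant 2023, §2 eq. (2)] [folklore] -/
theorem coeff_formalXMulSq_eq_zero_of_odd [IsAddTorsionFree R] {n : ℕ} (hn : Odd n) :
    coeff n W.formalXMulSq = 0 :=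
  coeff_eq_zero_of_rescale_neg_one_eq_self W.rescale_neg_one_formalXMulSq hn

/-- The odd coefficients of `η` vanish (`a₁ = a₃ = 0`, torsion-free ring). [folklore] -/
theorem coeff_formalEta_eq_zero_of_odd [IsAddTorsionFree R] {n : ℕ} (hn : Odd n) :
    coeff n W.formalEta = 0 :=
  coeff_eq_zero_of_rescale_neg_one_eq_self W.rescale_neg_one_formalEta hn

end CharNeTwoNF

section RatAlgebra

variable {A : Type*} [CommRing A] [Algebra ℚ A] (V : WeierstrassCurve A) [V.IsCharNeTwoNF]

/-- **`ω(-z) = ω(z)`: the expansion `ω/dz = W(z)` of the invariant differential is EVEN** for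
`a₁ = a₃ = 0` (it is `η⁻¹`). [Blakestad–Grant 2023, proof of Prop. 3(c); Silverman AEC IV.1]
[cite: BlakestadGrant2023, Prop. 3] -/
theorem rescale_neg_one_formalOmega : rescale (-1 : A) V.formalOmega = V.formalOmega := by
  have h1 : V.formalOmega * V.formalEta = 1 := V.formalOmega_mul_formalEta
  have h2 : rescale (-1 : A) V.formalOmega * V.formalEta = 1 := by
    have e := congrArg (rescale (-1 : A)) h1
    rwa [map_mul, map_one, V.rescale_neg_one_formalEta] at e
  calc rescale (-1 : A) V.formalOmega
      = rescale (-1 : A) V.formalOmega * (V.formalOmega * V.formalEta) := by rw [h1, mul_one]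
    _ = (rescale (-1 : A) V.formalOmega * V.formalEta) * V.formalOmega := by ring
    _ = V.formalOmega := by rw [h2, one_mul]

/-- **"There is no quadratic term in the expansion of `ω`"** (and no odd-degree term at all):
`[zⁿ](ω/dz) = 0` for odd `n` when `a₁ = a₃ = 0` and the coefficients are torsion-free — the
observation behind Blakestad–Grant's Prop. 3(c) (`a_n = H_n`, `b_n = -J_n`). [Blakestad–Grant 2023,
proof of Prop. 3(c)] [cite: BlakestadGrant2023, Prop. 3] -/
theorem coeff_formalOmega_eq_zero_of_odd [IsAddTorsionFree A] {n : ℕ} (hn : Odd n) :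
    coeff n V.formalOmega = 0 :=
  coeff_eq_zero_of_rescale_neg_one_eq_self V.rescale_neg_one_formalOmega hn

/-- For `a₁ = a₃ = 0` a Mazur–Tate sigma pair over `ℚ_p` has an odd power series `σ`:
`σ(-z) = -σ(z)`. [Blakestad–Grant 2023, Thm. 1; Mazur–Stein–Tate 2006, Thm. 1.3] [folklore] -/
theorem IsMazurTateSigmaPair.rescale_neg_one {p : ℕ} [Fact p.Prime] {W' : WeierstrassCurve ℚ_[p]}
    [W'.IsCharNeTwoNF] {σ : ℚ_[p]⟦X⟧} {c : ℚ_[p]} (h : W'.IsMazurTateSigmaPair σ c) :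
    rescale (-1 : ℚ_[p]) σ = -σ :=
  W'.isFormallyOdd_iff_rescale_of_isCharNeTwoNF.mp h.odd

end RatAlgebra

end WeierstrassCurve
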